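import Literature.MathematicalPhysics.QuantumFieldTheory.Balaban1983to89.B15TreeGraph196
import Literature.MathematicalPhysics.QuantumFieldTheory.Balaban1983to89.T4TreeGaugeFixing

/-!
# `Balaban1983to89.B15TreeGaugeFixing196` — [Balaban1989LargeFieldI] p. 196: *"Using the Faddeev–Popov procedure we
# introduce the gauge fixing δ-function δ_{T₀}(V′) in the integral (1.76)"* — PROVED AT MEASURE LEVEL for the tree `T`
# of one pair `P₁ ⊃ P₂` and for `T₀` (single-scale model), transported to the cell's torus: the bond sets carry a
# peeling certificate (`T4AxialGaugeFixing.TreeOrder`), contain no closed loop, and for every measurable integrand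
# invariant under the gauge transformations at the sites of `P₁∖P₂` (resp. of `𝔅₀`) one has
# `∫ F dV′ = ∫ F(V′[T := 1]) dV′` — unit Faddeev–Popov factor (row `B15.Def@196`)

statement-level skeleton of published theorems with citation tags; proofs where landed; nothing here is a claim about
the Yang–Mills mass gap.

CITATION HEADER (lean-in-tree rule 2026-08-18).  T. Bałaban, *Large field renormalization. I. The basic step of the 𝐑
operation*, Commun. Math. Phys. **122**, 175–202 (1989), doi:10.1007/BF01257412, bib `Balaban1989LargeFieldI` (cell paper
B15; PDF held `paper:balaban1989-cmp122-large-field-i`, journal page = PDF page + 174; pp. 195–196 READ AS IMAGES on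
the x2 renders `…/1989-cmp122-large-field-I/1989-cmp122-large-field-I-p021-x2.png`, `…-p022-x2.png`).
P. 195, verbatim: *"The measure and the underintegral expressions in the second integral in (1.76) are gauge invariant;
more precisely they are invariant with respect to the gauge transformations defined on 𝔅₀. We remove this invariance
by fixing a gauge for the variables V′."*  P. 196, verbatim: *"The union of all the contours is a tree graph T on
P₁∖P₂ … We fix the gauge putting the bond variables equal to 1 for bonds belonging to the tree graph. … The union of
the above described tree graphs and bonds is denoted by T₀. It is a tree graph in 𝔅₀, fixing completely a gauge in
this set. Using the Faddeev–Popov procedure we introduce the gauge fixing δ-function δ_{T₀}(V′) in the integral (1.76)."*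

WHAT IS REPRODUCED (mega-formalization `lit-balaban`, HOME `run/shared/lean/pub/lit-balaban/`, reader/typer r12 gen 6;
SKELETON row **B15.Def@196**, whose cell after gen 5 read «absent: … δ_{T₀}(V′)»).  The combinatorics is
`B15TreeGraph196` (this seat, p244540/p244776: the contours `Γ_{y,x}`, the tree `tree l u l′ u′ a` = `T`, its parent
structure `par`/`pbond`/`rank`, `tree_eq_image`, `pbond_injOn`, `rank_par_lt`; the single-scale `T0 L U A m` over a
`Chain` of nested boxes with the external bonds `extBond`).  The measure theory is the cell's tree-gauge package
`T4AxialGaugeFixing`/`T4TreeGaugeFixing` (b2b-balaban, [folklore]: `TreeOrder`, `fixBonds`,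
`lintegral_eq_lintegral_fixBonds_of_treeOrder`, `TreeOrder.noClosedLoop`, `lintegral_eq_lintegral_glue`,
`expectation_eq_reduced`), used BY NAME.  THIS FILE supplies the bridge: §1 the transport of `ℤ^{n+2}`-points/unit bonds
to the torus `Site P j`/`PBond P j` along a coordinate identification `σ : Fin (n+2) ≃ Fin P.d` (`castPt`, `castBond`,
injective on a non-wrapping box); §2 **`treeOrder_tree`**: the torus image of `T` carries a `TreeOrder` (fresh end of the
parent bond of `z` = `z`, rank = `B15TreeGraph196.rank`) — hence `noClosedLoop_tree`; §3 the printed gauge fixing for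
`T`: **`lintegral_eq_lintegral_fixTree`** (`∫ F dU = ∫ F(U[T := 1]) dU` for measurable `F ≥ 0` invariant under the
one-site gauge transformations at the sites of `P₁∖P₂` other than `y` — print's «invariant with respect to the gauge
transformations defined on 𝔅₀»), the gauge-invariant corollary, the reduced-integral form (integration over the free
bonds only) and the expectation form; §4 the same for `T₀`: the public twin `pbAt`/`parAt` of the bond entering each
site (external bond at a root, parent bond elsewhere), `mem_T0_iff_pbAt`, the layer-lexicographic rank `rankAll`,
**`treeOrder_T0`**, `noClosedLoop_T0`, **`lintegral_eq_lintegral_fixT0`** and corollaries.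

HONEST SCOPE.  (1) `T₀` is the SINGLE-SCALE model of `B15TreeGraph196` §8 (all layers on one unit lattice; print's layers
live on lattices of different scales — the multi-scale attachment is not modelled here either).  (2) *"δ_{T₀}(V′)"* is
rendered, as everywhere in the cell's T4 lineage, by the measure identity against the full product Haar measure
(`fixBonds`: the fixed coordinates are still integrated over, trivially) and by the reduced integral over the free bonds
(`T4TreeGaugeFixing.glue`/`freeMeasure`); no δ-function object is introduced — for tree gauges the Faddeev–Popov
determinant is `1`, which is the content of the identities.  (3) The transport to the torus asks that the bounding box
does not wrap (`u_i − l_i < sitesPerDir`; in print `Λ` lies in a cube of size `100M`, p. 192, far below the torus size).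
(4) `G` is any `GaugeGroup` with `HaarData` and measurable multiplication (the T4 setting).  Every declaration is a
definition with a body or a theorem proved from the two imports; nothing printed is asserted as a fact; NOT summit progress.
-/

noncomputable section

open MeasureTheory Finset
open scoped ENNReal

namespace Literature.MathematicalPhysics.QuantumFieldTheory.Balaban1983to89.B15TreeGaugeFixing196

open B6BondElimination (unitVec unitVec_apply)
open B7Prop1Explicit (e e_apply)
open T4AxialGaugeSmallField (castSite castSite_apply castSite_add_e castSite_injOn_box)
open T4AxialGaugeFixing (TreeOrder fixBonds siteTransf lintegral_eq_lintegral_fixBonds_of_treeOrder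
  lintegral_eq_lintegral_fixBonds map_eq_map_fixBonds integral_eq_integral_fixBonds)
open T4TreeGaugeFixing (NoClosedLoop glue freeMeasure lintegral_eq_lintegral_glue expectation_eq_reduced)
open B15TreeGraph196
open GaugeField (gaugeAct GaugeInvariant)

variable {n : ℕ} {P : Params} {j : ℕ}

/-! ## §1  Transport of lattice points and unit bonds of `ℤ^{n+2}` to the torus -/

section Transport

variable (σ : Fin (n + 2) ≃ Fin P.d)

/-- Re-indexing of the coordinates along `σ : Fin (n+2) ≃ Fin P.d` (the lattice `ℤ^{n+2}` of `B15TreeGraph196` read as the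
`ℤ^d` of the cell's torus charts). [cite: Balaban1989LargeFieldI, p.195] -/
def toZd (z : LPt n) : Fin P.d → ℤ := fun κ => z (σ.symm κ)

/-- Coordinates of `toZd`. [cite: Balaban1989LargeFieldI, p.195] -/
@[simp] theorem toZd_apply (z : LPt n) (κ : Fin P.d) : toZd σ z κ = z (σ.symm κ) := rfl

/-- `toZd` is injective. [cite: Balaban1989LargeFieldI, p.195] -/
theorem toZd_injective : Function.Injective (toZd σ : LPt n → Fin P.d → ℤ) := by
  intro z z' h
  funext i
  have := congr_fun h (σ i)
  simpa [toZd] using this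

/-- `toZd (z + e_μ) = toZd z + e_{σ μ}`. [cite: Balaban1989LargeFieldI, p.195] -/
theorem toZd_add_unitVec (z : LPt n) (μ : Fin (n + 2)) : toZd σ (z + unitVec μ) = toZd σ z + e (σ μ) := by
  funext κ
  simp only [toZd_apply, Pi.add_apply, unitVec_apply, e_apply]
  by_cases h : κ = σ μ
  · have h' : σ.symm κ = μ := by rw [h, Equiv.symm_apply_apply]
    rw [if_pos h', if_pos h]
  · have h' : σ.symm κ ≠ μ := fun h' => h (by rw [← h', Equiv.apply_symm_apply])
    rw [if_neg h', if_neg h]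

/-- THE TORUS POINT of a lattice point (print: *"We may assume, rescaling properly, that it is the unit lattice"*, p. 195 —
the unit lattice of the cell is the torus `Site P j`; `castSite` of `T4AxialGaugeSmallField`). [cite: Balaban1989LargeFieldI, p.195] -/
def castPt (z : LPt n) : Site P j := castSite (toZd σ z)

/-- THE TORUS BOND of a unit bond `⟨z, z + e_μ⟩`. [cite: Balaban1989LargeFieldI, p.195] -/
def castBond (b : LBond n) : PBond P j := ⟨castPt σ b.1, σ b.2⟩

/-- Source of a transported bond. [cite: Balaban1989LargeFieldI, p.195] -/
@[simp] theorem castBond_src (b : LBond n) : (castBond σ b : PBond P j).src = castPt σ b.1 := rfl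

/-- Direction of a transported bond. [cite: Balaban1989LargeFieldI, p.195] -/
@[simp] theorem castBond_dir (b : LBond n) : (castBond σ b : PBond P j).dir = σ b.2 := rfl

/-- Target of a transported bond: the torus point of the far end `z + e_μ`. [cite: Balaban1989LargeFieldI, p.195] -/
theorem castBond_tgt (b : LBond n) : (castBond σ b : PBond P j).tgt = castPt σ b.hi := by
  show (castSite (toZd σ b.1) : Site P j).shift (σ b.2) = castSite (toZd σ (b.1 + unitVec b.2))
  rw [toZd_add_unitVec, castSite_add_e]

variable {σ}

/-- `castPt` is injective on the lattice points of a NON-WRAPPING box (`u_i − l_i < sitesPerDir` in every direction).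
[cite: Balaban1989LargeFieldI, p.195] -/
theorem castPt_inj_of_mem_box {l u : LPt n} (hN : ∀ i, u i - l i < P.sitesPerDir j) {z z' : LPt n}
    (hz : z ∈ box l u) (hz' : z' ∈ box l u) (h : (castPt σ z : Site P j) = castPt σ z') : z = z' := by
  have hN' : ∀ κ, toZd σ u κ - toZd σ l κ < P.sitesPerDir j := fun κ => hN (σ.symm κ)
  rw [mem_box] at hz hz'
  have h1 : toZd σ l ≤ toZd σ z := fun κ => (hz (σ.symm κ)).1
  have h2 : toZd σ z ≤ toZd σ u := fun κ => (hz (σ.symm κ)).2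
  have h3 : toZd σ l ≤ toZd σ z' := fun κ => (hz' (σ.symm κ)).1
  have h4 : toZd σ z' ≤ toZd σ u := fun κ => (hz' (σ.symm κ)).2
  exact toZd_injective σ (castSite_injOn_box hN' h1 h2 h3 h4 h)

/-- `castBond` is injective on bonds whose lower ends lie in a non-wrapping box. [cite: Balaban1989LargeFieldI, p.195] -/
theorem castBond_inj_of_mem_box {l u : LPt n} (hN : ∀ i, u i - l i < P.sitesPerDir j) {b b' : LBond n}
    (hb : b.1 ∈ box l u) (hb' : b'.1 ∈ box l u) (h : (castBond σ b : PBond P j) = castBond σ b') : b = b' := by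
  have hd : σ b.2 = σ b'.2 := by have := congrArg PBond.dir h; simpa using this
  have hs : (castPt σ b.1 : Site P j) = castPt σ b'.1 := by have := congrArg PBond.src h; simpa using this
  exact Prod.ext (castPt_inj_of_mem_box hN hb hb' hs) (σ.injective hd)

/-- A unit bond is not a loop: `z ≠ z + e_μ`. [folklore] -/
private theorem fst_ne_hi (b : LBond n) : b.1 ≠ b.hi := by
  intro h
  have := congr_fun h b.2
  simp [LBond.hi, unitVec_apply] at this

end Transport

/-! ## §2  The torus image of the tree `T` of one pair `P₁ ⊃ P₂` carries a peeling certificate -/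

section OneTree

variable (σ : Fin (n + 2) ≃ Fin P.d) (l u l' u' : LPt n) (a : ℤ)

open scoped Classical in
/-- THE FRESH END of a bond of the transported tree: for the parent bond of `z` (`pbond z`, joining `z` to the point
preceding it on `Γ_{y,z}`) it is the torus point of `z` (off the tree: the source, never used).
[cite: Balaban1989LargeFieldI, p.196] -/
def freshEnd (b : PBond P j) : Site P j :=
  if h : ∃ z, z ∈ (ann l u l' u').erase l ∧ (castBond σ (pbond l u a z) : PBond P j) = b then castPt σ (Classical.choose h)
  else b.src

open scoped Classical in
/-- THE RANK on the torus: the rank `B15TreeGraph196.rank` of the lattice point of `P₁` under the torus site (`0` off the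
box). [cite: Balaban1989LargeFieldI, p.196] -/
def rankT (s : Site P j) : ℕ :=
  if h : ∃ z, z ∈ box l u ∧ (castPt σ z : Site P j) = s then rank l u a (Classical.choose h) else 0

variable {σ l u l' u' a}

/-- Points of `P₁∖P₂` are points of `P₁`. [folklore] -/
private theorem mem_box_of_mem_ann {z : LPt n} (hz : z ∈ ann l u l' u') : z ∈ box l u := (mem_ann.1 hz).1

/-- The lower end of a parent bond lies in `P₁`. [cite: Balaban1989LargeFieldI, p.196] -/
theorem pbond_fst_mem_box (h : Adm l u l' u' a) {z : LPt n} (hz : z ∈ ann l u l' u') (hzl : z ≠ l) :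
    (pbond l u a z).1 ∈ box l u := by
  rcases pbond_ends l u a z with ⟨e1, -⟩ | ⟨e1, -⟩
  · rw [e1]; exact mem_box_of_mem_ann (par_mem h hz hzl)
  · rw [e1]; exact mem_box_of_mem_ann hz

/-- The fresh end of the transported parent bond of `z` is the torus point of `z` (non-wrapping box).
[cite: Balaban1989LargeFieldI, p.196] -/
theorem freshEnd_castBond_pbond (h : Adm l u l' u' a) (hN : ∀ i, u i - l i < P.sitesPerDir j) {z : LPt n}
    (hz : z ∈ ann l u l' u') (hzl : z ≠ l) :
    freshEnd σ l u l' u' a (castBond σ (pbond l u a z) : PBond P j) = castPt σ z := by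
  classical
  have hex : ∃ z', z' ∈ (ann l u l' u').erase l ∧
      (castBond σ (pbond l u a z') : PBond P j) = castBond σ (pbond l u a z) :=
    ⟨z, Finset.mem_erase.2 ⟨hzl, hz⟩, rfl⟩
  rw [freshEnd, dif_pos hex]
  obtain ⟨hz'm, hz'e⟩ := Classical.choose_spec hex
  obtain ⟨hz'l, hz'⟩ := Finset.mem_erase.1 hz'm
  have hb : pbond l u a (Classical.choose hex) = pbond l u a z :=
    castBond_inj_of_mem_box hN (pbond_fst_mem_box h hz' hz'l) (pbond_fst_mem_box h hz hzl) hz'e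
  have hzz : Classical.choose hex = z :=
    pbond_injOn h (Finset.mem_coe.2 hz'm) (Finset.mem_coe.2 (Finset.mem_erase.2 ⟨hzl, hz⟩)) hb
  rw [hzz]

/-- The torus rank of the torus point of `z ∈ P₁` is `rank z` (non-wrapping box). [cite: Balaban1989LargeFieldI, p.196] -/
theorem rankT_castPt (hN : ∀ i, u i - l i < P.sitesPerDir j) {z : LPt n} (hz : z ∈ box l u) :
    rankT σ l u a (castPt σ z : Site P j) = rank l u a z := by
  classical
  have hex : ∃ z', z' ∈ box l u ∧ (castPt σ z' : Site P j) = castPt σ z := ⟨z, hz, rfl⟩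
  rw [rankT, dif_pos hex]
  obtain ⟨hz', he⟩ := Classical.choose_spec hex
  rw [castPt_inj_of_mem_box hN hz' hz he]

/-- **THE TRANSPORTED TREE `T` CARRIES A PEELING CERTIFICATE** (`T4AxialGaugeFixing.TreeOrder`): fresh end of the parent bond
of `z` = `z`, rank = the rank of `B15TreeGraph196` (strictly decreasing toward `y` along the parent map), for an admissible
pair on a non-wrapping box `P₁`. [cite: Balaban1989LargeFieldI, p.196] -/
theorem treeOrder_tree [DecidableEq (PBond P j)] (h : Adm l u l' u' a) (hN : ∀ i, u i - l i < P.sitesPerDir j) :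
    TreeOrder ((tree l u l' u' a).image (castBond σ) : Finset (PBond P j)) (freshEnd σ l u l' u' a)
      (rankT σ l u a) := by
  have key : ∀ b ∈ ((tree l u l' u' a).image (castBond σ) : Finset (PBond P j)),
      ∃ z, z ∈ ann l u l' u' ∧ z ≠ l ∧ castBond σ (pbond l u a z) = b := by
    intro b hb
    obtain ⟨b₀, hb₀, rfl⟩ := Finset.mem_image.1 hb
    obtain ⟨z, hz, hzl, rfl⟩ := exists_pbond_of_mem_tree h hb₀
    exact ⟨z, hz, hzl, rfl⟩
  refine ⟨fun b hb => ?_, fun b hb => ?_, fun b hb b' hb' hvv => ?_, fun b hb => ?_⟩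
  · -- endpoint
    obtain ⟨z, hz, hzl, rfl⟩ := key b hb
    rw [freshEnd_castBond_pbond h hN hz hzl]
    rcases pbond_ends l u a z with ⟨-, e2⟩ | ⟨e1, -⟩
    · right; rw [castBond_tgt, e2]
    · left; rw [castBond_src, e1]
  · -- no loop
    obtain ⟨z, hz, hzl, rfl⟩ := key b hb
    rw [castBond_src, castBond_tgt]
    intro hst
    have hends := tree_ends_mem h (pbond_mem_tree h hz hzl)
    exact fst_ne_hi _ (castPt_inj_of_mem_box hN (mem_box_of_mem_ann hends.1) (mem_box_of_mem_ann hends.2) hst)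
  · -- distinct bonds have distinct fresh ends
    obtain ⟨z, hz, hzl, rfl⟩ := key b hb
    obtain ⟨z', hz', hz'l, rfl⟩ := key b' hb'
    rw [freshEnd_castBond_pbond h hN hz hzl, freshEnd_castBond_pbond h hN hz' hz'l] at hvv
    rw [castPt_inj_of_mem_box hN (mem_box_of_mem_ann hz) (mem_box_of_mem_ann hz') hvv]
  · -- rank increases toward the fresh end
    obtain ⟨z, hz, hzl, rfl⟩ := key b hb
    have hlt := rank_par_lt h hz hzl
    have hpm := mem_box_of_mem_ann (par_mem h hz hzl)
    rw [freshEnd_castBond_pbond h hN hz hzl, rankT_castPt hN (mem_box_of_mem_ann hz), castBond_src, castBond_tgt]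
    rcases pbond_ends l u a z with ⟨e1, -⟩ | ⟨-, e2⟩
    · left; rw [e1, rankT_castPt hN hpm]; exact hlt
    · right; rw [e2, rankT_castPt hN hpm]; exact hlt

/-- Hence the transported tree contains NO CLOSED LOOP (`T4TreeGaugeFixing.NoClosedLoop`; «a tree graph»).
[cite: Balaban1989LargeFieldI, p.196] -/
theorem noClosedLoop_tree [DecidableEq (PBond P j)] (h : Adm l u l' u' a) (hN : ∀ i, u i - l i < P.sitesPerDir j) :
    NoClosedLoop ((tree l u l' u' a).image (castBond σ) : Finset (PBond P j)) :=
  (treeOrder_tree (σ := σ) h hN).noClosedLoop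

end OneTree

/-! ## §3  p. 196: «We fix the gauge putting the bond variables equal to 1 for bonds belonging to the tree graph» —
the Faddeev–Popov identity for `T`, at measure level -/

section FixOneTree

variable {σ : Fin (n + 2) ≃ Fin P.d} {l u l' u' : LPt n} {a : ℤ}
variable {G : Type*} [GaugeGroup G] [MeasurableSpace G] [HaarData G] [MeasurableMul G] [DecidableEq (PBond P j)]

/-- **TREE GAUGE FIXING ON `P₁∖P₂` (the printed invariance: gauge transformations at the sites of the region).**  For an
admissible pair on a non-wrapping box and a measurable `F ≥ 0` invariant under the one-site gauge transformations at the
torus points of `P₁∖P₂` other than `y`:  `∫ F dU = ∫ F(U[T := 1]) dU`, `T` = the transported tree.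
[cite: Balaban1989LargeFieldI, p.196] -/
theorem lintegral_eq_lintegral_fixTree_of_inv (h : Adm l u l' u' a) (hN : ∀ i, u i - l i < P.sitesPerDir j)
    {F : GaugeField P j G → ℝ≥0∞} (hF : Measurable F)
    (hinv : ∀ z ∈ ann l u l' u', z ≠ l → ∀ (g : G) (U : GaugeField P j G),
      F (gaugeAct (siteTransf (castPt σ z) g) U) = F U) :
    ∫⁻ U, F U ∂fieldMeasure P j G =
      ∫⁻ U, F (fixBonds ((tree l u l' u' a).image (castBond σ)) U) ∂fieldMeasure P j G := by
  refine lintegral_eq_lintegral_fixBonds_of_treeOrder (treeOrder_tree (σ := σ) h hN) hF fun b hb g U => ?_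
  obtain ⟨b₀, hb₀, rfl⟩ := Finset.mem_image.1 hb
  obtain ⟨z, hz, hzl, rfl⟩ := exists_pbond_of_mem_tree h hb₀
  rw [freshEnd_castBond_pbond h hN hz hzl]
  exact hinv z hz hzl g U

/-- **TREE GAUGE FIXING ON `P₁∖P₂`, gauge-invariant integrands**: `∫ F dU = ∫ F(U[T := 1]) dU`.
[cite: Balaban1989LargeFieldI, p.196] -/
theorem lintegral_eq_lintegral_fixTree (h : Adm l u l' u' a) (hN : ∀ i, u i - l i < P.sitesPerDir j)
    {F : GaugeField P j G → ℝ≥0∞} (hF : Measurable F) (hinv : GaugeInvariant F) :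
    ∫⁻ U, F U ∂fieldMeasure P j G =
      ∫⁻ U, F (fixBonds ((tree l u l' u' a).image (castBond σ)) U) ∂fieldMeasure P j G :=
  lintegral_eq_lintegral_fixBonds (treeOrder_tree (σ := σ) h hN) hF hinv

omit [MeasurableSpace G] [HaarData G] [MeasurableMul G] in
/-- After the fixing the bond variables on the tree ARE `1`: `U[T := 1](b) = 1` for `b ∈ T` (the content of `δ_T`).
[cite: Balaban1989LargeFieldI, p.196] -/
theorem fixTree_apply_of_mem_tree {b : LBond n} (hb : b ∈ tree l u l' u' a) (U : GaugeField P j G) :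
    fixBonds ((tree l u l' u' a).image (castBond σ)) U (castBond σ b) = 1 :=
  T4AxialGaugeFixing.fixBonds_apply_of_mem (Finset.mem_image_of_mem _ hb) U

/-- LAW FORM: a gauge-invariant measurable `F` into any measurable space has the same law as `F ∘ (·)[T := 1]`.
[cite: Balaban1989LargeFieldI, p.196] -/
theorem map_eq_map_fixTree (h : Adm l u l' u' a) (hN : ∀ i, u i - l i < P.sitesPerDir j)
    {α : Type*} [MeasurableSpace α] {F : GaugeField P j G → α} (hF : Measurable F) (hinv : GaugeInvariant F) :
    (fieldMeasure P j G).map F =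
      (fieldMeasure P j G).map (fun U => F (fixBonds ((tree l u l' u' a).image (castBond σ)) U)) :=
  map_eq_map_fixBonds (treeOrder_tree (σ := σ) h hN) hF hinv

/-- BOCHNER FORM (real gauge-invariant measurable `F`). [cite: Balaban1989LargeFieldI, p.196] -/
theorem integral_eq_integral_fixTree (h : Adm l u l' u' a) (hN : ∀ i, u i - l i < P.sitesPerDir j)
    {F : GaugeField P j G → ℝ} (hF : Measurable F) (hinv : GaugeInvariant F) :
    ∫ U, F U ∂fieldMeasure P j G =
      ∫ U, F (fixBonds ((tree l u l' u' a).image (castBond σ)) U) ∂fieldMeasure P j G :=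
  integral_eq_integral_fixBonds (treeOrder_tree (σ := σ) h hN) hF hinv

/-- REDUCED-INTEGRAL FORM (the shape of a δ-function gauge fixing: integrate over the free bonds only, the tree bonds
frozen at any prescribed `U₀`, e.g. `1`): `∫ F dU = ∫ F(U₀ on T, W off T) ∏_{b ∉ T} dW(b)` — via
`T4TreeGaugeFixing.lintegral_eq_lintegral_glue`. [cite: Balaban1989LargeFieldI, p.196] -/
theorem lintegral_eq_lintegral_glue_tree (h : Adm l u l' u' a) (hN : ∀ i, u i - l i < P.sitesPerDir j)
    (U₀ : GaugeField P j G) {F : GaugeField P j G → ℝ≥0∞} (hF : Measurable F) (hinv : GaugeInvariant F) :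
    ∫⁻ U, F U ∂fieldMeasure P j G =
      ∫⁻ W, F (glue ((tree l u l' u' a).image (castBond σ)) U₀ W)
        ∂freeMeasure ((tree l u l' u' a).image (castBond σ)) :=
  lintegral_eq_lintegral_glue (noClosedLoop_tree (σ := σ) h hN) U₀ hF hinv

/-- EXPECTATION FORM: for gauge-invariant measurable `f, ρ ≥ 0` the normalized expectation `∫ fρ / ∫ ρ` may be computed with
the tree bonds frozen, numerator and denominator alike. [cite: Balaban1989LargeFieldI, p.196] -/
theorem expectation_eq_reduced_tree (h : Adm l u l' u' a) (hN : ∀ i, u i - l i < P.sitesPerDir j)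
    (U₀ : GaugeField P j G) {f ρ : GaugeField P j G → ℝ≥0∞} (hf : Measurable f) (hfi : GaugeInvariant f)
    (hρ : Measurable ρ) (hρi : GaugeInvariant ρ) :
    (∫⁻ U, f U * ρ U ∂fieldMeasure P j G) / (∫⁻ U, ρ U ∂fieldMeasure P j G) =
      (∫⁻ W, f (glue ((tree l u l' u' a).image (castBond σ)) U₀ W) *
          ρ (glue ((tree l u l' u' a).image (castBond σ)) U₀ W) ∂freeMeasure ((tree l u l' u' a).image (castBond σ))) /
        (∫⁻ W, ρ (glue ((tree l u l' u' a).image (castBond σ)) U₀ W)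
          ∂freeMeasure ((tree l u l' u' a).image (castBond σ))) :=
  expectation_eq_reduced (noClosedLoop_tree (σ := σ) h hN) U₀ hf hfi hρ hρi

end FixOneTree

/-! ## §4  The same for `T₀ = ⋃ (trees) ∪ (external bonds)` (single-scale model of `B15TreeGraph196` §8) -/

section ChainT0

variable {L U : ℕ → LPt n} {A : ℕ → ℤ} {m : ℕ}

/-- A chain restricts to any shorter chain. [cite: Balaban1989LargeFieldI, p.196] -/
theorem Chain.le' (h : Chain m L U A) {k : ℕ} (hk : k ≤ m) : Chain k L U A :=
  ⟨fun i hi => h.adm i (lt_of_lt_of_le hi hk), fun i hi => h.nest i (lt_of_lt_of_le hi hk)⟩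

/-- THE BOND OF `T₀` ENTERING THE SITE `z` OF THE LAYER `P^i ∖ P^{i+1}`: the external bond `⟨l^i − e₁, l^i⟩` at the root
`l^i`, the parent bond of the tree `T(P^i, P^{i+1})` elsewhere (public twin of the bookkeeping of `B15TreeGraph196` §8).
[cite: Balaban1989LargeFieldI, p.196] -/
def pbAt (L U : ℕ → LPt n) (A : ℕ → ℤ) (i : ℕ) (z : LPt n) : LBond n :=
  if z = L i then extBond L i else pbond (L i) (U i) (A i) z

/-- THE OTHER END of that bond: `l^i − e₁` at the root, the tree parent elsewhere. [cite: Balaban1989LargeFieldI, p.196] -/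
def parAt (L U : ℕ → LPt n) (A : ℕ → ℤ) (i : ℕ) (z : LPt n) : LPt n :=
  if z = L i then L i - unitVec 0 else par (L i) (U i) (A i) z

/-- `pbAt i z` joins `z` and `parAt i z`. [cite: Balaban1989LargeFieldI, p.196] -/
theorem pbAt_ends (L U : ℕ → LPt n) (A : ℕ → ℤ) (i : ℕ) (z : LPt n) :
    ((pbAt L U A i z).1 = parAt L U A i z ∧ (pbAt L U A i z).hi = z) ∨
      ((pbAt L U A i z).1 = z ∧ (pbAt L U A i z).hi = parAt L U A i z) := by
  unfold pbAt parAt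
  by_cases hz : z = L i
  · rw [if_pos hz, if_pos hz]
    left
    refine ⟨rfl, ?_⟩
    rw [LBond.hi, extBond, hz]
    simp
  · rw [if_neg hz, if_neg hz]
    exact pbond_ends (L i) (U i) (A i) z

/-- The layers are pairwise disjoint. [cite: Balaban1989LargeFieldI, p.196] -/
theorem layer_disjoint (h : Chain m L U A) {i i' : ℕ} (hii' : i < i') (hi' : i' < m) :
    Disjoint (layer L U i) (layer L U i') := by
  rw [Finset.disjoint_left]
  intro z hz hz'
  have hsub : box (L i') (U i') ⊆ box (L (i + 1)) (U (i + 1)) :=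
    h.box_subset (i := i + 1) (j := i') (by omega) (le_of_lt hi')
  exact (mem_ann.1 hz).2 (hsub (mem_ann.1 hz').1)

/-- A point lies in at most one layer. [cite: Balaban1989LargeFieldI, p.196] -/
theorem layer_eq_of_mem (h : Chain m L U A) {i i' : ℕ} (hi : i < m) (hi' : i' < m) {z : LPt n}
    (hz : z ∈ layer L U i) (hz' : z ∈ layer L U i') : i = i' := by
  by_contra hne
  rcases lt_or_gt_of_ne hne with hlt | hlt
  · exact Finset.disjoint_left.1 (layer_disjoint h hlt hi') hz hz'
  · exact Finset.disjoint_left.1 (layer_disjoint h hlt hi) hz' hz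

/-- The outer root `y − e₁` lies in no layer. [cite: Balaban1989LargeFieldI, p.196] -/
theorem outRoot_not_mem_layer (h : Chain m L U A) {i : ℕ} (hi : i < m) : outRoot L ∉ layer L U i := by
  intro hz
  have hzm : outRoot L ∈ box (L i) (U i) := (mem_ann.1 hz).1
  have h0 := h.box_subset (Nat.zero_le i) (le_of_lt hi) hzm
  rw [mem_box] at h0
  have := (h0 0).1
  simp [outRoot, unitVec_apply] at this

/-- **`T₀` IS THE SET OF THE BONDS `pbAt i z`** over the layers `i < m` and their sites `z`. [cite: Balaban1989LargeFieldI, p.196] -/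
theorem mem_T0_iff_pbAt (h : Chain m L U A) {b : LBond n} :
    b ∈ T0 L U A m ↔ ∃ i, i < m ∧ ∃ z, z ∈ layer L U i ∧ pbAt L U A i z = b := by
  simp only [T0, Finset.mem_union, Finset.mem_biUnion, Finset.mem_range, Finset.mem_image]
  constructor
  · rintro (⟨i, hi, hb⟩ | ⟨i, hi, rfl⟩)
    · obtain ⟨z, hz, hzl, rfl⟩ := exists_pbond_of_mem_tree (h.adm i hi) hb
      exact ⟨i, hi, z, hz, by rw [pbAt, if_neg hzl]⟩
    · refine ⟨i, hi, L i, (Chain.le' h (by omega : i + 1 ≤ m)).root_mem_layer, by rw [pbAt, if_pos rfl]⟩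
  · rintro ⟨i, hi, z, hz, rfl⟩
    by_cases hzl : z = L i
    · right; exact ⟨i, hi, by rw [pbAt, if_pos hzl]⟩
    · left; exact ⟨i, hi, by rw [pbAt, if_neg hzl]; exact pbond_mem_tree (h.adm i hi) hz hzl⟩

/-- A strict upper bound for all the tree ranks occurring in the chain. [cite: Balaban1989LargeFieldI, p.196] -/
def bigB (L U : ℕ → LPt n) (A : ℕ → ℤ) (m : ℕ) : ℕ :=
  ((Finset.range m).sup fun i => (layer L U i).sup (rank (L i) (U i) (A i))) + 1

/-- Every tree rank in the chain is below `bigB`. [cite: Balaban1989LargeFieldI, p.196] -/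
theorem rank_lt_bigB {i : ℕ} (hi : i < m) {z : LPt n} (hz : z ∈ layer L U i) :
    rank (L i) (U i) (A i) z < bigB L U A m := by
  have h1 : rank (L i) (U i) (A i) z ≤ (layer L U i).sup (rank (L i) (U i) (A i)) := Finset.le_sup hz
  have h2 : (layer L U i).sup (rank (L i) (U i) (A i)) ≤
      (Finset.range m).sup fun i => (layer L U i).sup (rank (L i) (U i) (A i)) :=
    Finset.le_sup (f := fun i => (layer L U i).sup (rank (L i) (U i) (A i))) (Finset.mem_range.2 hi)
  unfold bigB
  omega

/-- THE GLOBAL RANK of `T₀`: layer-lexicographic — a site of the `i`-th layer gets `(i+1)·B + (its tree rank)`, the outer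
root gets `0`. [cite: Balaban1989LargeFieldI, p.196] -/
def rankAll (L U : ℕ → LPt n) (A : ℕ → ℤ) (m : ℕ) (z : LPt n) : ℕ :=
  ∑ i ∈ Finset.range m, if z ∈ layer L U i then (i + 1) * bigB L U A m + rank (L i) (U i) (A i) z else 0

/-- The global rank on the `i`-th layer. [cite: Balaban1989LargeFieldI, p.196] -/
theorem rankAll_of_mem (h : Chain m L U A) {i : ℕ} (hi : i < m) {z : LPt n} (hz : z ∈ layer L U i) :
    rankAll L U A m z = (i + 1) * bigB L U A m + rank (L i) (U i) (A i) z := by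
  unfold rankAll
  rw [Finset.sum_eq_single_of_mem i (Finset.mem_range.2 hi)]
  · rw [if_pos hz]
  · intro i' hi' hne
    rw [if_neg]
    intro hz'
    exact hne (layer_eq_of_mem h (Finset.mem_range.1 hi') hi hz' hz)

/-- The global rank of the outer root is `0`. [cite: Balaban1989LargeFieldI, p.196] -/
theorem rankAll_outRoot (h : Chain m L U A) : rankAll L U A m (outRoot L) = 0 := by
  unfold rankAll
  refine Finset.sum_eq_zero fun i hi => ?_
  rw [if_neg (outRoot_not_mem_layer h (Finset.mem_range.1 hi))]

/-- The global rank of a site already present (`sites L U i` = outer root and layers `< i`) is below `i·B`.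
[cite: Balaban1989LargeFieldI, p.196] -/
theorem rankAll_lt_of_mem_sites (h : Chain m L U A) {i : ℕ} (hi : i ≤ m) {z : LPt n} (hz : z ∈ sites L U i) :
    rankAll L U A m z < (i + 1) * bigB L U A m := by
  have hB : 1 ≤ bigB L U A m := by unfold bigB; omega
  rw [sites, Finset.mem_union, Finset.mem_singleton, Finset.mem_biUnion] at hz
  rcases hz with rfl | ⟨i', hi', hz⟩
  · rw [rankAll_outRoot h]
    have : 1 * 1 ≤ (i + 1) * bigB L U A m := Nat.mul_le_mul (by omega) hB
    omega
  · rw [Finset.mem_range] at hi'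
    rw [rankAll_of_mem h (by omega) hz]
    have hr := rank_lt_bigB (L := L) (U := U) (A := A) (m := m) (by omega : i' < m) hz
    have hmono : (i' + 1 + 1) * bigB L U A m ≤ (i + 1) * bigB L U A m := Nat.mul_le_mul_right _ (by omega)
    have e : (i' + 1 + 1) * bigB L U A m = (i' + 1) * bigB L U A m + bigB L U A m := by ring
    omega

/-- THE GLOBAL RANK DECREASES along every bond of `T₀`, from the site it enters to its other end.
[cite: Balaban1989LargeFieldI, p.196] -/
theorem rankAll_parAt_lt (h : Chain m L U A) {i : ℕ} (hi : i < m) {z : LPt n} (hz : z ∈ layer L U i) :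
    rankAll L U A m (parAt L U A i z) < rankAll L U A m z := by
  rw [rankAll_of_mem h hi hz]
  by_cases hzl : z = L i
  · rw [parAt, if_pos hzl]
    have hc : L i - unitVec 0 ∈ sites L U i := (Chain.le' h (by omega : i + 1 ≤ m)).conn_mem_sites
    have := rankAll_lt_of_mem_sites h (le_of_lt hi) hc
    omega
  · rw [parAt, if_neg hzl]
    have hp : par (L i) (U i) (A i) z ∈ layer L U i := par_mem (h.adm i hi) hz hzl
    rw [rankAll_of_mem h hi hp]
    have := rank_par_lt (h.adm i hi) hz hzl
    omega

/-- The other end of the bond entering `z` is a site of `T₀`'s carrier after the `i`-th layer. [cite: Balaban1989LargeFieldI, p.196] -/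
theorem parAt_mem_sites (h : Chain m L U A) {i : ℕ} (hi : i < m) {z : LPt n} (hz : z ∈ layer L U i) :
    parAt L U A i z ∈ sites L U (i + 1) := by
  rw [sites_succ, Finset.mem_union]
  by_cases hzl : z = L i
  · left; rw [parAt, if_pos hzl]; exact (Chain.le' h (by omega : i + 1 ≤ m)).conn_mem_sites
  · right; rw [parAt, if_neg hzl]; exact par_mem (h.adm i hi) hz hzl

/-- THE BOUNDING BOX `[y − e₁ ∧ l^0, u^0]` of all the sites: lower corner `outRoot L = l^0 − e₁`. Every layer point lies in
it. [cite: Balaban1989LargeFieldI, p.196] -/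
theorem mem_bbox_of_mem_layer (h : Chain m L U A) {i : ℕ} (hi : i < m) {z : LPt n} (hz : z ∈ layer L U i) :
    z ∈ box (outRoot L) (U 0) := by
  have hz0 : z ∈ box (L 0) (U 0) := h.box_subset (Nat.zero_le i) (le_of_lt hi) (mem_ann.1 hz).1
  rw [mem_box] at hz0 ⊢
  intro q
  refine ⟨?_, (hz0 q).2⟩
  have := (hz0 q).1
  by_cases hq : q = 0
  · subst hq; simp [outRoot, unitVec_apply]; omega
  · simp [outRoot, unitVec_apply, hq]; exact this

/-- Every site of the carrier lies in the bounding box (for a nonempty chain). [cite: Balaban1989LargeFieldI, p.196] -/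
theorem mem_bbox_of_mem_sites (h : Chain m L U A) (hm : 0 < m) {i : ℕ} (hi : i ≤ m) {z : LPt n}
    (hz : z ∈ sites L U i) : z ∈ box (outRoot L) (U 0) := by
  rw [sites, Finset.mem_union, Finset.mem_singleton, Finset.mem_biUnion] at hz
  rcases hz with rfl | ⟨i', hi', hz⟩
  · have hle := (h.adm 0 hm).le
    rw [mem_box]
    intro q
    refine ⟨le_rfl, ?_⟩
    by_cases hq : q = 0
    · subst hq; simp [outRoot, unitVec_apply]; have := hle 0; omega
    · simp [outRoot, unitVec_apply, hq]; exact hle q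
  · exact mem_bbox_of_mem_layer h (by rw [Finset.mem_range] at hi'; omega) hz

/-- Both ends of every bond of `T₀` lie in the bounding box. [cite: Balaban1989LargeFieldI, p.196] -/
theorem pbAt_fst_mem_bbox (h : Chain m L U A) {i : ℕ} (hi : i < m) {z : LPt n} (hz : z ∈ layer L U i) :
    (pbAt L U A i z).1 ∈ box (outRoot L) (U 0) ∧ (pbAt L U A i z).hi ∈ box (outRoot L) (U 0) := by
  have hzb := mem_bbox_of_mem_layer h hi hz
  have hpb := mem_bbox_of_mem_sites h (by omega) (by omega : i + 1 ≤ m) (parAt_mem_sites h hi hz)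
  rcases pbAt_ends L U A i z with ⟨e1, e2⟩ | ⟨e1, e2⟩
  · rw [e1, e2]; exact ⟨hpb, hzb⟩
  · rw [e1, e2]; exact ⟨hzb, hpb⟩

/-- Distinct (layer, site) pairs have distinct entering bonds. [cite: Balaban1989LargeFieldI, p.196] -/
theorem pbAt_inj (h : Chain m L U A) {i i' : ℕ} (hi : i < m) (hi' : i' < m) {z z' : LPt n}
    (hz : z ∈ layer L U i) (hz' : z' ∈ layer L U i') (hb : pbAt L U A i z = pbAt L U A i' z') :
    i = i' ∧ z = z' := by
  have hzz : z = z' := by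
    have E1 := pbAt_ends L U A i z
    have E2 := pbAt_ends L U A i' z'
    rw [hb] at E1
    rcases E1 with ⟨a1, b1⟩ | ⟨a1, b1⟩ <;> rcases E2 with ⟨a2, b2⟩ | ⟨a2, b2⟩
    · exact b1.symm.trans b2
    · -- two-cycle: z = parAt z', z' = parAt z — excluded by the ranks
      have e1 : z' = parAt L U A i z := a2.symm.trans a1
      have e2 : z = parAt L U A i' z' := b1.symm.trans b2
      have r1 := rankAll_parAt_lt h hi hz
      have r2 := rankAll_parAt_lt h hi' hz'
      rw [← e1] at r1; rw [← e2] at r2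
      omega
    · have e1 : z = parAt L U A i' z' := a1.symm.trans a2
      have e2 : z' = parAt L U A i z := b2.symm.trans b1
      have r1 := rankAll_parAt_lt h hi hz
      have r2 := rankAll_parAt_lt h hi' hz'
      rw [← e2] at r1; rw [← e1] at r2
      omega
    · exact a1.symm.trans a2
  subst hzz
  exact ⟨layer_eq_of_mem h hi hi' hz hz', rfl⟩

end ChainT0

section ChainT0Torus

variable (σ : Fin (n + 2) ≃ Fin P.d) (L U : ℕ → LPt n) (A : ℕ → ℤ) (m : ℕ)

open scoped Classical in
/-- THE FRESH END of a bond of the transported `T₀`: the torus point of the site it enters. [cite: Balaban1989LargeFieldI, p.196] -/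
def freshEnd0 (b : PBond P j) : Site P j :=
  if h : ∃ iz : ℕ × LPt n, (iz.1 < m ∧ iz.2 ∈ layer L U iz.1) ∧ (castBond σ (pbAt L U A iz.1 iz.2) : PBond P j) = b
  then castPt σ (Classical.choose h).2 else b.src

open scoped Classical in
/-- THE RANK on the torus: the global rank of the lattice point of the bounding box under the torus site.
[cite: Balaban1989LargeFieldI, p.196] -/
def rank0 (s : Site P j) : ℕ :=
  if h : ∃ z, z ∈ box (outRoot L) (U 0) ∧ (castPt σ z : Site P j) = s then rankAll L U A m (Classical.choose h) else 0

variable {σ L U A m}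

/-- The fresh end of the transported bond entering `z` is the torus point of `z` (non-wrapping bounding box).
[cite: Balaban1989LargeFieldI, p.196] -/
theorem freshEnd0_castBond_pbAt (h : Chain m L U A) (hN : ∀ q, U 0 q - outRoot L q < P.sitesPerDir j) {i : ℕ}
    (hi : i < m) {z : LPt n} (hz : z ∈ layer L U i) :
    freshEnd0 σ L U A m (castBond σ (pbAt L U A i z) : PBond P j) = castPt σ z := by
  classical
  have hex : ∃ iz : ℕ × LPt n, (iz.1 < m ∧ iz.2 ∈ layer L U iz.1) ∧
      (castBond σ (pbAt L U A iz.1 iz.2) : PBond P j) = castBond σ (pbAt L U A i z) := ⟨(i, z), ⟨hi, hz⟩, rfl⟩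
  rw [freshEnd0, dif_pos hex]
  obtain ⟨⟨hi', hz'⟩, he⟩ := Classical.choose_spec hex
  have hb := castBond_inj_of_mem_box hN (pbAt_fst_mem_bbox h hi' hz').1 (pbAt_fst_mem_bbox h hi hz).1 he
  rw [(pbAt_inj h hi' hi hz' hz hb).2]

/-- The torus rank of the torus point of a bounding-box point is its global rank. [cite: Balaban1989LargeFieldI, p.196] -/
theorem rank0_castPt (hN : ∀ q, U 0 q - outRoot L q < P.sitesPerDir j) {z : LPt n} (hz : z ∈ box (outRoot L) (U 0)) :
    rank0 σ L U A m (castPt σ z : Site P j) = rankAll L U A m z := by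
  classical
  have hex : ∃ z', z' ∈ box (outRoot L) (U 0) ∧ (castPt σ z' : Site P j) = castPt σ z := ⟨z, hz, rfl⟩
  rw [rank0, dif_pos hex]
  obtain ⟨hz', he⟩ := Classical.choose_spec hex
  rw [castPt_inj_of_mem_box hN hz' hz he]

/-- **THE TRANSPORTED `T₀` CARRIES A PEELING CERTIFICATE**: fresh end of the bond entering `z` = `z`, rank = the
layer-lexicographic global rank; for a chain whose bounding box `[l^0 − e₁, u^0]` does not wrap around the torus.
[cite: Balaban1989LargeFieldI, p.196] -/
theorem treeOrder_T0 [DecidableEq (PBond P j)] (h : Chain m L U A) (hN : ∀ q, U 0 q - outRoot L q < P.sitesPerDir j) :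
    TreeOrder ((T0 L U A m).image (castBond σ) : Finset (PBond P j)) (freshEnd0 σ L U A m) (rank0 σ L U A m) := by
  have key : ∀ b ∈ ((T0 L U A m).image (castBond σ) : Finset (PBond P j)),
      ∃ i, i < m ∧ ∃ z, z ∈ layer L U i ∧ castBond σ (pbAt L U A i z) = b := by
    intro b hb
    obtain ⟨b₀, hb₀, rfl⟩ := Finset.mem_image.1 hb
    obtain ⟨i, hi, z, hz, rfl⟩ := (mem_T0_iff_pbAt h).1 hb₀
    exact ⟨i, hi, z, hz, rfl⟩
  refine ⟨fun b hb => ?_, fun b hb => ?_, fun b hb b' hb' hvv => ?_, fun b hb => ?_⟩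
  · obtain ⟨i, hi, z, hz, rfl⟩ := key b hb
    rw [freshEnd0_castBond_pbAt h hN hi hz]
    rcases pbAt_ends L U A i z with ⟨-, e2⟩ | ⟨e1, -⟩
    · right; rw [castBond_tgt, e2]
    · left; rw [castBond_src, e1]
  · obtain ⟨i, hi, z, hz, rfl⟩ := key b hb
    rw [castBond_src, castBond_tgt]
    intro hst
    have hends := pbAt_fst_mem_bbox h hi hz
    exact fst_ne_hi _ (castPt_inj_of_mem_box hN hends.1 hends.2 hst)
  · obtain ⟨i, hi, z, hz, rfl⟩ := key b hb
    obtain ⟨i', hi', z', hz', rfl⟩ := key b' hb'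
    rw [freshEnd0_castBond_pbAt h hN hi hz, freshEnd0_castBond_pbAt h hN hi' hz'] at hvv
    have hzz := castPt_inj_of_mem_box hN (mem_bbox_of_mem_layer h hi hz) (mem_bbox_of_mem_layer h hi' hz') hvv
    subst hzz
    rw [layer_eq_of_mem h hi hi' hz hz']
  · obtain ⟨i, hi, z, hz, rfl⟩ := key b hb
    have hlt := rankAll_parAt_lt h hi hz
    have hpm := mem_bbox_of_mem_sites h (by omega) (by omega : i + 1 ≤ m) (parAt_mem_sites h hi hz)
    rw [freshEnd0_castBond_pbAt h hN hi hz, rank0_castPt hN (mem_bbox_of_mem_layer h hi hz), castBond_src,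
      castBond_tgt]
    rcases pbAt_ends L U A i z with ⟨e1, -⟩ | ⟨-, e2⟩
    · left; rw [e1, rank0_castPt hN hpm]; exact hlt
    · right; rw [e2, rank0_castPt hN hpm]; exact hlt

/-- Hence the transported `T₀` contains no closed loop («It is a tree graph in 𝔅₀»). [cite: Balaban1989LargeFieldI, p.196] -/
theorem noClosedLoop_T0 [DecidableEq (PBond P j)] (h : Chain m L U A)
    (hN : ∀ q, U 0 q - outRoot L q < P.sitesPerDir j) :
    NoClosedLoop ((T0 L U A m).image (castBond σ) : Finset (PBond P j)) :=
  (treeOrder_T0 (σ := σ) h hN).noClosedLoop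

end ChainT0Torus

/-! ### p. 196: «Using the Faddeev–Popov procedure we introduce the gauge fixing δ-function δ_{T₀}(V′) in the integral
(1.76)» — at measure level -/

section FixT0

variable {σ : Fin (n + 2) ≃ Fin P.d} {L U : ℕ → LPt n} {A : ℕ → ℤ} {m : ℕ}
variable {G : Type*} [GaugeGroup G] [MeasurableSpace G] [HaarData G] [MeasurableMul G] [DecidableEq (PBond P j)]

/-- **`δ_{T₀}(V′)`, THE PRINTED INVARIANCE** («invariant with respect to the gauge transformations defined on 𝔅₀»): for a
measurable `F ≥ 0` invariant under the one-site gauge transformations at the torus points of the layers `P^i ∖ P^{i+1}`,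
`i < m` (the sites of `𝔅₀` whose gauge freedom `T₀` uses), `∫ F dV′ = ∫ F(V′[T₀ := 1]) dV′`.
[cite: Balaban1989LargeFieldI, p.196] -/
theorem lintegral_eq_lintegral_fixT0_of_inv (h : Chain m L U A) (hN : ∀ q, U 0 q - outRoot L q < P.sitesPerDir j)
    {F : GaugeField P j G → ℝ≥0∞} (hF : Measurable F)
    (hinv : ∀ i, i < m → ∀ z ∈ layer L U i, ∀ (g : G) (V : GaugeField P j G),
      F (gaugeAct (siteTransf (castPt σ z) g) V) = F V) :
    ∫⁻ V, F V ∂fieldMeasure P j G =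
      ∫⁻ V, F (fixBonds ((T0 L U A m).image (castBond σ)) V) ∂fieldMeasure P j G := by
  refine lintegral_eq_lintegral_fixBonds_of_treeOrder (treeOrder_T0 (σ := σ) h hN) hF fun b hb g V => ?_
  obtain ⟨b₀, hb₀, rfl⟩ := Finset.mem_image.1 hb
  obtain ⟨i, hi, z, hz, rfl⟩ := (mem_T0_iff_pbAt h).1 hb₀
  rw [freshEnd0_castBond_pbAt h hN hi hz]
  exact hinv i hi z hz g V

/-- **`δ_{T₀}(V′)` for gauge-invariant integrands**: `∫ F dV′ = ∫ F(V′[T₀ := 1]) dV′`. [cite: Balaban1989LargeFieldI, p.196] -/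
theorem lintegral_eq_lintegral_fixT0 (h : Chain m L U A) (hN : ∀ q, U 0 q - outRoot L q < P.sitesPerDir j)
    {F : GaugeField P j G → ℝ≥0∞} (hF : Measurable F) (hinv : GaugeInvariant F) :
    ∫⁻ V, F V ∂fieldMeasure P j G =
      ∫⁻ V, F (fixBonds ((T0 L U A m).image (castBond σ)) V) ∂fieldMeasure P j G :=
  lintegral_eq_lintegral_fixBonds (treeOrder_T0 (σ := σ) h hN) hF hinv

omit [MeasurableSpace G] [HaarData G] [MeasurableMul G] in
/-- After the fixing the bond variables on `T₀` are `1`. [cite: Balaban1989LargeFieldI, p.196] -/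
theorem fixT0_apply_of_mem_T0 {b : LBond n} (hb : b ∈ T0 L U A m) (V : GaugeField P j G) :
    fixBonds ((T0 L U A m).image (castBond σ)) V (castBond σ b) = 1 :=
  T4AxialGaugeFixing.fixBonds_apply_of_mem (Finset.mem_image_of_mem _ hb) V

/-- LAW FORM for `T₀`. [cite: Balaban1989LargeFieldI, p.196] -/
theorem map_eq_map_fixT0 (h : Chain m L U A) (hN : ∀ q, U 0 q - outRoot L q < P.sitesPerDir j)
    {α : Type*} [MeasurableSpace α] {F : GaugeField P j G → α} (hF : Measurable F) (hinv : GaugeInvariant F) :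
    (fieldMeasure P j G).map F =
      (fieldMeasure P j G).map (fun V => F (fixBonds ((T0 L U A m).image (castBond σ)) V)) :=
  map_eq_map_fixBonds (treeOrder_T0 (σ := σ) h hN) hF hinv

/-- BOCHNER FORM for `T₀`. [cite: Balaban1989LargeFieldI, p.196] -/
theorem integral_eq_integral_fixT0 (h : Chain m L U A) (hN : ∀ q, U 0 q - outRoot L q < P.sitesPerDir j)
    {F : GaugeField P j G → ℝ} (hF : Measurable F) (hinv : GaugeInvariant F) :
    ∫ V, F V ∂fieldMeasure P j G =
      ∫ V, F (fixBonds ((T0 L U A m).image (castBond σ)) V) ∂fieldMeasure P j G :=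
  integral_eq_integral_fixBonds (treeOrder_T0 (σ := σ) h hN) hF hinv

/-- REDUCED-INTEGRAL FORM for `T₀` (integration over the free bonds only, `T₀` frozen at any `U₀`).
[cite: Balaban1989LargeFieldI, p.196] -/
theorem lintegral_eq_lintegral_glue_T0 (h : Chain m L U A) (hN : ∀ q, U 0 q - outRoot L q < P.sitesPerDir j)
    (U₀ : GaugeField P j G) {F : GaugeField P j G → ℝ≥0∞} (hF : Measurable F) (hinv : GaugeInvariant F) :
    ∫⁻ V, F V ∂fieldMeasure P j G =
      ∫⁻ W, F (glue ((T0 L U A m).image (castBond σ)) U₀ W) ∂freeMeasure ((T0 L U A m).image (castBond σ)) :=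
  lintegral_eq_lintegral_glue (noClosedLoop_T0 (σ := σ) h hN) U₀ hF hinv

/-- EXPECTATION FORM for `T₀`: normalized expectations of gauge-invariant densities may be computed with `T₀` frozen.
[cite: Balaban1989LargeFieldI, p.196] -/
theorem expectation_eq_reduced_T0 (h : Chain m L U A) (hN : ∀ q, U 0 q - outRoot L q < P.sitesPerDir j)
    (U₀ : GaugeField P j G) {f ρ : GaugeField P j G → ℝ≥0∞} (hf : Measurable f) (hfi : GaugeInvariant f)
    (hρ : Measurable ρ) (hρi : GaugeInvariant ρ) :
    (∫⁻ V, f V * ρ V ∂fieldMeasure P j G) / (∫⁻ V, ρ V ∂fieldMeasure P j G) =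
      (∫⁻ W, f (glue ((T0 L U A m).image (castBond σ)) U₀ W) *
          ρ (glue ((T0 L U A m).image (castBond σ)) U₀ W) ∂freeMeasure ((T0 L U A m).image (castBond σ))) /
        (∫⁻ W, ρ (glue ((T0 L U A m).image (castBond σ)) U₀ W) ∂freeMeasure ((T0 L U A m).image (castBond σ))) :=
  expectation_eq_reduced (noClosedLoop_T0 (σ := σ) h hN) U₀ hf hfi hρ hρi

end FixT0

end Literature.MathematicalPhysics.QuantumFieldTheory.Balaban1983to89.B15TreeGaugeFixing196

end
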